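import Summits.KontsevichZagierPeriods.Zeta5Search.DualSeriesLemma19Coeffs
import HarnessLib

/-!
# ζ(5) search — Zudilin's Lemma 19 denominators for `F̃₇(b)`, III: pole orders and the printed constant-term
denominator `D_{m₁}D_{m₂}⋯D_{m₆}` (cell `pub-zeta5`, P1)

HONEST FRAMING: systematic search; no irrationality claim unless certified.

OUR instantiation (Summit side, P1 seat generation 4) of [Zudilin2004, §8 Lemma 19, (8.10)–(8.12)], completing
`DualSeriesLemma19Coeffs`: the ORDER-DEPENDENT windows.  A partial-fraction coefficient `c_{o,p}` of a product of
simple-pole bricks vanishes as soon as at most `o` of the bricks have a pole at `p` (`exists_pf_prod_supp`, the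
support-tracking twin of `BallRivoal.exists_pf_prod`; integer linear factors do not move poles, `linSteps_supp`).
For `R_b` in Zudilin's self-paired grouping this says (`window_support_order`): THE data satisfy `c_{o,p} = 0` unless
at least `o + 1` of the six windows `b_j ≤ p ≤ b₀ − b_j` (`j = 2,…,7`) contain `p` — for sorted slots
`b₂ ≤ ⋯ ≤ b₇`, unless `b_{o+2} ≤ p ≤ b₀ − b_{o+2}` (Zudilin: `B_{jk} = 0` unless `h_j ≤ k ≤ h₀ − h_j`).  Consequently
(`coeffV_den19_sorted`) the constant term is cleared by `d₁d₂⋯d₆ · Ñ(b)` whenever each `d_i` is a common multiple of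
`1,…,b₀ − 2σ` and of `1,…,b₀ − b₁ − b_{i+1}` — the printed `D_{m₁}D_{m₂}⋯D_{m₆}`, `m_i = max{m₀, h₀ − h₁ − h_{1+i}}`
(record direction `(41;17,…,11)·n` after sorting: `18n + 5·17n = 103n`, versus `246n` in `DualSeriesDenominators`).
Not here: the prime-by-prime factor `Φ` of (8.8)–(8.9).
-/

noncomputable section

open Finset Polynomial
open Literature.NumberTheory.Transcendental
open Literature.NumberTheory.Transcendental.BallRivoal

namespace Summit.KontsevichZagierPeriods.Zeta5Search

namespace DualSeriesLemma19

open DualSeries WedgeDictionary PFSteps DualSeriesDenominators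

/-! ### Pole orders of a product of bricks -/

/-- The number of the first `K` bricks with a pole at position `p`. -/
def brickMult (A : ℕ → ℕ → ℤ) (K p : ℕ) : ℕ := ((range K).filter fun s => A s p ≠ 0).card

/-- One more brick. -/
theorem brickMult_succ (A : ℕ → ℕ → ℤ) (K p : ℕ) :
    brickMult A (K + 1) p = brickMult A K p + (if A K p ≠ 0 then 1 else 0) := by
  unfold brickMult
  rw [range_add_one, filter_insert]
  split_ifs with h
  · rw [card_insert_of_notMem (by simp)]
  · rw [add_zero]

/-- Monotonicity in the predicate: bricks with a pole at `p` are among those whose window contains `p`. -/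
theorem brickMult_le_card (A : ℕ → ℕ → ℤ) (K p : ℕ) (P : ℕ → Prop) [DecidablePred P]
    (h : ∀ s, s < K → A s p ≠ 0 → P s) : brickMult A K p ≤ ((range K).filter P).card := by
  unfold brickMult
  exact card_le_card (fun s hs => by
    rw [mem_filter] at hs ⊢
    exact ⟨hs.1, h s (mem_range.1 hs.1) hs.2⟩)

/-- **Partial fractions of a product of bricks, with pole orders**: the data can be chosen with `c_{o,p} = 0`
whenever at most `o` of the bricks have a pole at `p` (same construction as `BallRivoal.exists_pf_prod`). -/
theorem exists_pf_prod_supp (n : ℕ) (A : ℕ → ℕ → ℤ) (K : ℕ) (hK : 1 ≤ K) :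
    ∃ c : ℕ → ℕ → ℚ,
      (∀ t : ℚ, (∀ p, p ≤ n → t + p + 1 ≠ 0) →
        pfEval n K c t = ∏ s ∈ range K, brickEval n (A s) t) ∧
      (∀ o p, brickMult A K p ≤ o → c o p = 0) := by
  induction K, hK using Nat.le_induction with
  | base =>
    refine ⟨fun o p => if o = 0 then (A 0 p : ℚ) else 0, fun t _ => by simp [pfEval, brickEval], ?_⟩
    intro o p h
    by_cases ho : o = 0
    · subst ho
      have hA : A 0 p = 0 := by
        by_contra hne
        have : 1 ≤ brickMult A 1 p := by
          unfold brickMult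
          exact card_pos.2 ⟨0, by simp [hne]⟩
        omega
      simp [hA]
    · simp [ho]
  | succ K hK ih =>
    obtain ⟨c, hc, hsupp⟩ := ih
    refine ⟨∑ o ∈ range K, ∑ j ∈ range (n + 1), ∑ m ∈ range (n + 1),
      contrib (c o j) (A K m) o j m, ?_, ?_⟩
    · intro t ht
      rw [prod_range_succ, ← hc t ht, pfEval_sum]
      simp only [pfEval_sum]
      have h1 : ∀ o ∈ range K, ∀ j ∈ range (n + 1), ∀ m ∈ range (n + 1),
          pfEval n (K + 1) (contrib (c o j) (A K m) o j m) t =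
            c o j / (t + j + 1) ^ (o + 1) * ((A K m : ℚ) / (t + m + 1)) := by
        intro o ho j hj m hm
        rw [pfEval_contrib n K (c o j) (A K m) (mem_range.1 ho) (Nat.lt_succ_iff.1 (mem_range.1 hj))
          (Nat.lt_succ_iff.1 (mem_range.1 hm)) t ht]
        have := ht j (Nat.lt_succ_iff.1 (mem_range.1 hj))
        have := ht m (Nat.lt_succ_iff.1 (mem_range.1 hm))
        field_simp
      rw [sum_congr rfl fun o ho => sum_congr rfl fun j hj => sum_congr rfl fun m hm => h1 o ho j hj m hm]
      unfold pfEval brickEval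
      rw [sum_comm, sum_mul]
      refine sum_congr rfl fun j _ => ?_
      rw [sum_mul]
      refine sum_congr rfl fun o _ => ?_
      rw [mul_sum]
    · intro o' p hmult
      rw [brickMult_succ] at hmult
      have hK' : brickMult A K p ≤ o' := by
        by_cases hA : A K p ≠ 0
        · rw [if_pos hA] at hmult; omega
        · rw [if_neg hA] at hmult; omega
      simp only [Finset.sum_apply]
      refine sum_eq_zero fun o ho => sum_eq_zero fun j _ => sum_eq_zero fun m _ => ?_
      unfold contrib
      by_cases hmj : m = j
      · rw [if_pos hmj]
        unfold single
        split_ifs with h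
        · obtain ⟨h1', h2'⟩ := h
          by_cases hA : A K p = 0
          · rw [hmj, ← h2', hA]; simp
          · have hle : brickMult A K p ≤ o := by rw [if_pos hA] at hmult; omega
            rw [← h2', hsupp o p hle]; simp
        · rfl
      · rw [if_neg hmj]
        simp only [Pi.add_apply, Finset.sum_apply]
        unfold single
        rw [sum_eq_zero fun o₁ ho₁ => ?_, zero_add]
        · split_ifs with h
          · obtain ⟨h1', h2'⟩ := h
            have hA : A K p = 0 := by
              by_contra hne
              rw [if_pos hne] at hmult
              omega
            rw [← h2', hA]; simp
          · rfl
        · split_ifs with h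
          · obtain ⟨h1', h2'⟩ := h
            have hle : brickMult A K p ≤ o := by have := mem_range.1 ho₁; omega
            rw [← h2', hsupp o p hle]; simp
          · rfl

/-- Integer linear steps do not create poles: the order bound `c_{o,p} = 0 whenever μ(p) ≤ o` is preserved. -/
theorem linSteps_supp (μ : ℕ → ℕ) {c : ℕ → ℕ → ℚ} (h : ∀ o p, μ p ≤ o → c o p = 0) :
    ∀ L : List (ℤ × ℤ), ∀ o p, μ p ≤ o → linSteps L c o p = 0
  | [], o, p, ho => h o p ho
  | (α, β) :: L, o, p, ho => by
    rw [linSteps, linStep, linSteps_supp μ h L (o + 1) p (by omega), linSteps_supp μ h L o p ho]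
    ring

/-! ### Pole orders of `R_b` in the window -/

/-- **THE partial-fraction data of `R_b` respect the pole orders of Zudilin's grouping**: `c_{o,p} = 0` unless at
least `o + 1` of the six windows `b_j ≤ p ≤ b₀ − b_j` (`j = 2,…,7`) contain `p` [Zudilin2004, §8: `B_{jk}` is indexed
by `k ∈ [h_j, h₀ − h_j]`]. -/
theorem window_support_order {b : ℕ → ℤ} (hb : InBox b)
    {σ : ℕ} (hσ : ∀ s, s < 6 → σ ≤ bn b (s + 2)) (h2 : ∀ s, s < 6 → 2 * bn b (s + 2) ≤ bn b 0)
    (h1 : bn b 1 ≤ σ) {c : ℕ → ℕ → ℚ} (hc : IsPFData b c) {o p : ℕ} (ho : o < 6) (hp : p ≤ bn b 0)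
    (hcard : ((range 6).filter fun s => bn b (s + 2) ≤ p ∧ p ≤ bn b 0 - bn b (s + 2)).card ≤ o) :
    c o p = 0 := by
  have h2σ : 2 * σ ≤ bn b 0 := by have := hσ 0 (by norm_num); have := h2 0 (by norm_num); omega
  have hwin : σ + wtop b σ ≤ bn b 0 := by unfold wtop; omega
  obtain ⟨c₀, hc₀, hsupp₀⟩ := exists_pf_prod_supp (wtop b σ) (brickW b σ) 6 (by norm_num)
  have hc₁s : ∀ o p, 6 ≤ o → trunc 6 c₀ o p = 0 := fun o p ho => trunc_of_le ho p
  set e : ℕ → ℕ → ℚ := linSteps (linFactorsW b σ) (trunc 6 c₀) with he_def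
  set Q : ℚ[X] := polyPart (wtop b σ) (linFactorsW b σ) (trunc 6 c₀) with hQ_def
  have hsupp_e : ∀ o p', brickMult (brickW b σ) 6 p' ≤ o → e o p' = 0 := by
    intro o p' h
    refine linSteps_supp (brickMult (brickW b σ) 6) (fun o p h' => ?_) _ o p' h
    unfold trunc
    split_ifs
    · exact hsupp₀ o p h'
    · rfl
  have heval : ∀ t' : ℚ, (∀ p, p ≤ wtop b σ → t' + p + 1 ≠ 0) →
      pfEval (wtop b σ) 6 e t' + Q.eval t' =
        linProd (linFactorsW b σ) t' * ∏ s ∈ range 6, brickEval (wtop b σ) (brickW b σ s) t' := by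
    intro t' ht'
    have h1 := pfEval_linSteps (wtop b σ) 6 hc₁s t' ht' (linFactorsW b σ)
    rw [pfEval_trunc, hc₀ t' ht'] at h1
    exact h1
  set ê : ℕ → ℕ → ℚ := extendW σ (wtop b σ) e with hê_def
  have hnat : ∀ k : ℕ, 0 ≤ k →
      pfEval (bn b 0) 6 (fun o p => ê o p - (normaliser19 b : ℚ) * c o p) k
        + (Q.comp (X + C (σ : ℚ))).eval (k : ℚ) = 0 := by
    intro k _
    have hk : ∀ p, p ≤ bn b 0 → (k : ℚ) + p + 1 ≠ 0 := fun p _ => by positivity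
    have hk' : ∀ p, p ≤ wtop b σ → ((k : ℚ) + σ) + p + 1 ≠ 0 := fun p _ => by positivity
    have hks : ∀ p, p ≤ bn b 0 → ((k : ℚ) + σ - σ) + p + 1 ≠ 0 := fun p _ => by
      rw [add_sub_cancel_right]; positivity
    have E1 : pfEval (bn b 0) 6 ê k = pfEval (wtop b σ) 6 e ((k : ℚ) + σ) := pfEval_extendW _ _ _ _ hwin e _
    have E2 := heval ((k : ℚ) + σ) hk'
    have E3 := normaliser19_mul_eq hb hσ h2 ((k : ℚ) + σ) hks
    rw [add_sub_cancel_right] at E3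
    have E4 : pfEval (bn b 0) 6 c k
        = ((numPoly b).comp (X + C 1)).eval (k : ℚ) / poch ((k : ℚ) + 1) (bn b 0 + 1) ^ 6 := hc (k : ℚ) hk
    rw [pfEval_sub', pfEval_const_mul, E4, E1]
    rw [← E3] at E2
    simp only [eval_comp, eval_add, eval_X, eval_C] at E2 ⊢
    linear_combination E2
  obtain ⟨-, hzero⟩ := pf_unique_poly (bn b 0) 6 _ _ 0 hnat
  have hN : (normaliser19 b : ℚ) ≠ 0 := by
    rw [normaliser19]; exact_mod_cast (prod_ne_zero_iff.2 fun s _ => Nat.factorial_ne_zero _)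
  have hê : ê o p = (normaliser19 b : ℚ) * c o p := by have := hzero o p ho hp; linarith
  -- the extended window data vanish at (o, p)
  have hê0 : ê o p = 0 := by
    rw [hê_def, extendW]
    split_ifs with hw
    · apply hsupp_e
      refine (brickMult_le_card (brickW b σ) 6 (p - σ)
        (fun s => bn b (s + 2) ≤ p ∧ p ≤ bn b 0 - bn b (s + 2)) fun s hs hA => ?_).trans hcard
      -- a brick with a pole at `p - σ` has `p` in its window
      unfold brickW subRes at hA
      split_ifs at hA with hr
      · unfold wlen at hr
        have := hσ s hs
        have := h2 s hs
        omega
      · exact absurd rfl hA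
    · rfl
  rw [hê0] at hê
  exact (mul_eq_zero.1 hê.symm).resolve_left hN

/-! ### The printed constant-term denominator (sorted slots) -/

/-- Several common multiples clear a truncated zeta sum: `(∏_{i∈I} d_i) · H_q^{(|I|)} ∈ ℤ` when every `d_i` is a
common multiple of `1,…,q`. -/
theorem isInt_prod_mul_harm (I : Finset ℕ) (d : ℕ → ℕ) (q : ℕ)
    (hdiv : ∀ i ∈ I, ∀ l : ℕ, 1 ≤ l → l ≤ q → (l : ℤ) ∣ d i) :
    ∃ z : ℤ, (∏ i ∈ I, (d i : ℚ)) * harm I.card q = z := by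
  have hm : ∀ m ∈ range q, ∃ z : ℤ, (∏ i ∈ I, (d i : ℚ)) * (1 / ((m : ℚ) + 1) ^ I.card) = z := by
    intro m hm
    have hm' := mem_range.1 hm
    have hw : ∀ i ∈ I, ∃ w : ℤ, (d i : ℚ) / ((m : ℚ) + 1) = w := by
      intro i hi
      obtain ⟨w, hw⟩ := hdiv i hi (m + 1) (by omega) (by omega)
      refine ⟨w, ?_⟩
      have hw' : (d i : ℚ) = ((m + 1 : ℕ) : ℚ) * w := by exact_mod_cast hw
      rw [hw']; push_cast; field_simp
    choose w hw using hw
    refine ⟨∏ i ∈ I.attach, w i.1 i.2, ?_⟩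
    rw [one_div, ← inv_pow, ← card_attach, ← prod_const, ← prod_attach (s := I), ← prod_mul_distrib]
    push_cast
    exact prod_congr rfl fun i _ => by rw [← hw i.1 i.2, div_eq_mul_inv]
  choose z hz using hm
  refine ⟨∑ m ∈ (range q).attach, z m.1 m.2, ?_⟩
  rw [harm, mul_sum, ← sum_attach]
  push_cast
  exact sum_congr rfl fun m _ => hz m.1 m.2

/-- **`d₁d₂⋯d₆ · Ñ(b) · V(b) ∈ ℤ` — the printed exponents of Zudilin's Lemma 19 for the constant term**
[Zudilin2004, §8 Lemma 19, (8.10)–(8.12)]: for `b` in the box with `Σ_j b_j ≤ 3b₀+1`, slot 1 minimal and the other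
slots SORTED, `b₁ ≤ σ ≤ b₂ ≤ b₃ ≤ ⋯ ≤ b₇`, `2b_j ≤ b₀`: if each `d_i` (`i = 1,…,6`) is a common multiple of
`1,…,b₀ − 2σ` and of `1,…,b₀ − b₁ − b_{i+1}`, then `(∏_{i=1}^{6} d_i)·Ñ(b)·V(b)` is an integer
(`d_i = D_{m_i}`, `m_i = max{m₀, h₀ − h₁ − h_{1+i}}` with `σ = b₂`). -/
theorem coeffV_den19_sorted {b : ℕ → ℤ} (hb : InBox b) (hsum : ∑ j ∈ range 7, b (j + 1) ≤ 3 * b 0 + 1)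
    {σ : ℕ} (hσ : ∀ s, s < 6 → σ ≤ bn b (s + 2)) (h2 : ∀ s, s < 6 → 2 * bn b (s + 2) ≤ bn b 0)
    (h1 : bn b 1 ≤ σ) (hsort : ∀ s, s < 5 → bn b (s + 2) ≤ bn b (s + 3))
    (d : ℕ → ℕ) (hdw : ∀ i ∈ Icc 1 6, ∀ k : ℕ, 1 ≤ k → k ≤ wtop b σ → (k : ℤ) ∣ d i)
    (hdi : ∀ i ∈ Icc 1 6, ∀ k : ℕ, 1 ≤ k → k ≤ bn b 0 - bn b 1 - bn b (i + 1) → (k : ℤ) ∣ d i) :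
    ∃ z : ℤ, (∏ i ∈ Icc 1 6, (d i : ℚ)) * (normaliser19 b : ℚ) * coeffV b = z := by
  set D : ℕ := Nat.lcmUpto (wtop b σ) with hD
  have hDdiv : ∀ k : ℕ, 1 ≤ k → k ≤ wtop b σ → (k : ℤ) ∣ D := fun k h1' h2' => natCast_dvd_lcmUpto h1' h2'
  obtain ⟨c, hc, hint, hsupp, hvan⟩ := exists_window_data hb hsum hσ h2 h1 D hDdiv
  have h2σ : 2 * σ ≤ bn b 0 := by have := hσ 0 (by norm_num); have := h2 0 (by norm_num); omega
  -- each `d_i` is a multiple of `D`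
  have hDd : ∀ i ∈ Icc 1 6, ∃ u : ℤ, (d i : ℤ) = D * u := by
    intro i hi
    have h : (D : ℕ) ∣ d i := by
      rw [hD, Nat.lcmUpto]
      exact Finset.lcm_dvd fun k hk => by
        have hk' := mem_Icc.1 hk
        exact_mod_cast hdw i hi k hk'.1 hk'.2
    obtain ⟨u, hu⟩ := h
    exact ⟨u, by rw [hu]; push_cast; ring⟩
  -- sorted slots: at least `o+1` windows contain `p` only if window `o+2` does
  have hwin : ∀ o p, o < 6 → p ≤ bn b 0 → c o p ≠ 0 → bn b (o + 2) ≤ p ∧ p ≤ bn b 0 - bn b (o + 2) := by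
    intro o p ho hp hne
    by_contra hnot
    apply hne
    apply window_support_order hb hσ h2 h1 hc ho hp
    -- the windows containing `p` are among the first `o`
    have hsub : ((range 6).filter fun s => bn b (s + 2) ≤ p ∧ p ≤ bn b 0 - bn b (s + 2)) ⊆ range o := by
      intro s hs
      rw [mem_filter, mem_range] at hs
      rw [mem_range]
      by_contra hso
      push Not at hso
      -- s ≥ o: window s ⊆ window o (sorted), contradiction
      have hmono : bn b (o + 2) ≤ bn b (s + 2) := by
        have key : ∀ k, o + k < 6 → bn b (o + 2) ≤ bn b (o + k + 2) := by
          intro k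
          induction k with
          | zero => intro; simp
          | succ k ihk =>
            intro hk
            exact (ihk (by omega)).trans (by
              have := hsort (o + k) (by omega)
              rwa [show o + k + 3 = o + (k + 1) + 2 by ring] at this)
        have := key (s - o) (by omega)
        rwa [show o + (s - o) + 2 = s + 2 by omega] at this
      exact hnot ⟨hmono.trans hs.2.1, hs.2.2.trans (by omega)⟩
    exact (card_le_card hsub).trans (by rw [card_range])
  -- termwise integrality
  have hterm : ∀ o ∈ range 6, ∀ p ∈ range (bn b 0 + 1), ∃ z : ℤ,
      (∏ i ∈ Icc 1 6, (d i : ℚ)) * ((normaliser19 b : ℚ) * c o p * harm (o + 1) (p - bn b 1)) = z := by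
    intro o ho p hp
    have ho' := mem_range.1 ho
    have hp' := Nat.lt_succ_iff.1 (mem_range.1 hp)
    by_cases hne : c o p = 0
    · rw [hne]; exact ⟨0, by simp⟩
    obtain ⟨hlo, hhi⟩ := hwin o p ho' hp' hne
    -- split the product: `i ≤ o+1` clears the harmonic sum, `i ≥ o+2` clears the coefficient
    have hsplit : Icc 1 6 = Icc 1 (o + 1) ∪ Icc (o + 2) 6 := by
      ext i; simp only [mem_union, mem_Icc]; omega
    have hdisj : Disjoint (Icc 1 (o + 1)) (Icc (o + 2) 6) := by
      rw [disjoint_left]; intro i hi hi'; rw [mem_Icc] at hi hi'; omega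
    rw [hsplit, prod_union hdisj]
    -- harmonic part
    obtain ⟨zh, hzh⟩ := isInt_prod_mul_harm (Icc 1 (o + 1)) d (p - bn b 1) (fun i hi l hl1 hl2 => by
      have hi' := mem_Icc.1 hi
      refine hdi i (mem_Icc.2 ⟨hi'.1, by omega⟩) l hl1 ?_
      have hmono : bn b (i + 1) ≤ bn b (o + 2) := by
        have key : ∀ k, i + 1 + k ≤ 7 → bn b (i + 1) ≤ bn b (i + 1 + k) := by
          intro k
          induction k with
          | zero => intro; simp
          | succ k ihk =>
            intro hk
            exact (ihk (by omega)).trans (by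
              have := hsort (i + k - 1) (by omega)
              rwa [show i + k - 1 + 2 = i + 1 + k by omega, show i + k - 1 + 3 = i + 1 + (k + 1) by omega] at this)
        have := key (o + 1 - i) (by omega)
        rwa [show i + 1 + (o + 1 - i) = o + 2 by omega] at this
      omega)
    rw [Nat.card_Icc, show o + 1 + 1 - 1 = o + 1 by omega] at hzh
    -- coefficient part
    obtain ⟨zc, hzc⟩ := hint o p ho' hp'
    have hU : ∃ u : ℤ, (∏ i ∈ Icc (o + 2) 6, (d i : ℚ)) = (D : ℚ) ^ (5 - o) * u := by
      have hu : ∀ i ∈ Icc (o + 2) 6, ∃ u : ℤ, (d i : ℚ) = (D : ℚ) * u := by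
        intro i hi
        obtain ⟨u, hu⟩ := hDd i (mem_Icc.2 ⟨by have := (mem_Icc.1 hi).1; omega, (mem_Icc.1 hi).2⟩)
        exact ⟨u, by exact_mod_cast hu⟩
      choose u hu using hu
      refine ⟨∏ i ∈ (Icc (o + 2) 6).attach, u i.1 i.2, ?_⟩
      rw [← prod_attach (s := Icc (o + 2) 6)]
      push_cast
      rw [show (5 - o : ℕ) = (Icc (o + 2) 6).attach.card by rw [card_attach, Nat.card_Icc]; omega, ← prod_const,
        ← prod_mul_distrib]
      exact prod_congr rfl fun i _ => hu i.1 i.2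
    obtain ⟨u, hu⟩ := hU
    refine ⟨zh * zc * u, ?_⟩
    push_cast
    rw [hu, ← hzh, ← hzc]
    ring
  choose z hz using hterm
  refine ⟨∑ o ∈ (range 6).attach, ∑ p ∈ (range (bn b 0 + 1)).attach, z o.1 o.2 p.1 p.2, ?_⟩
  rw [mul_assoc, coeffV_shift_of hc h1 _ (fun o p ho hp hpσ => hsupp o p ho hp (fun h => by omega)) hvan,
    mul_sum, ← sum_attach]
  push_cast
  refine sum_congr rfl fun o _ => ?_
  rw [mul_sum, ← sum_attach]
  exact sum_congr rfl fun p _ => hz o.1 o.2 p.1 p.2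

end DualSeriesLemma19

end Summit.KontsevichZagierPeriods.Zeta5Search
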